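import Summits.CriticalPhenomena.PercolationContinuityZ3.Theorems.SahiMasterFamilySandwich

/-!
# The block expansion of Sahi's functional along one slot, every order

Unit `prim-master-conj` (crux anchor stmt-CriticalPhenomena-4575); the algebraic engine of the all-order programme (PROOF-ALLK.md / ALLK-NOTES.md of
the unit, identity (★)).  For a weight `μ`, functions `F_0,…,F_{q−1}` and one more function `h`, Sahi's functional of the family `(h, F)` expands along
the block containing `h` of the set-partition form [Sahi2008, eqs. (4)–(7)]:

  `E_{q+1}(h, F_0, …, F_{q−1}) = q!·E(h·Π_i F_i) − Σ_{T ⊊ [q]} |T|!·E(h·Π_{i∈T} F_i)·E_{q−|T|}(F|_{[q]∖T})`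

(`sahiE_cons_eq_block_expansion`; the sub-family `F|_{[q]∖T}` is enumerated increasingly, `F ∘ (univ \ T).orderEmbOfFin`, and its functional does not
depend on the enumeration, `sahiE_comp_strictMono_eq`).  When `h` kills the products `Π_{i∈T} F_i` for `T` in an up-closed family, only the other `T`
survive — the depth-one case is the tree's `sahiE_cons_cons_of_mul_eq_zero`, and the order-4/5 instances are the identities behind
`SahiMasterFamilyFourStep/FiveStep/ShrunkFrames`.  Proof: induction on `q` along the Lieb–Sahi recursion (`sahiE_fin_cons`): the `l`-th recursion
term is the same expansion one order down for the special function `F_l·h`, and the pairs `(l, T)` regroup into `T' = {l} ∪ l.succAbove(T)` with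
multiplicity `|T'|` (`|T'|·(|T'|−1)! = |T'|!`).  Pure algebra: any weight, any functions; axioms standard. [this work]
-/

noncomputable section

open scoped Classical

namespace Summit.CriticalPhenomena.PercolationContinuityZ3.Theorems

open Finset Function
open Literature.Combinatorics.Sahi2008

variable {α : Type*} [Fintype α]

/-! ### Sub-families enumerated increasingly -/

/-- `E` of a sub-family does not depend on the increasing enumeration used: any strictly monotone enumeration `g` of `s` gives
`E_{|s|}(F ∘ g) = E_{|s|}(F ∘ s.orderEmbOfFin)`. [this work] -/
theorem sahiE_comp_strictMono_eq (μ : α → ℝ) {m r : ℕ} (F : Fin m → α → ℝ) (s : Finset (Fin m)) (h : s.card = r)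
    (g : Fin r → Fin m) (hg : ∀ x, g x ∈ s) (hmono : StrictMono g) :
    sahiE μ r (fun i => F (g i)) = sahiE μ s.card (fun i => F (s.orderEmbOfFin rfl i)) := by
  subst h
  rw [orderEmbOfFin_unique rfl hg hmono]

/-- The full family as the sub-family indexed by `univ \ ∅`. [this work] -/
theorem sahiE_eq_subfamily_univ (μ : α → ℝ) {m : ℕ} (F : Fin m → α → ℝ) :
    sahiE μ m F = sahiE μ ((univ : Finset (Fin m)) \ ∅).card
      (fun i => F (((univ : Finset (Fin m)) \ ∅).orderEmbOfFin rfl i)) := by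
  have h : ((univ : Finset (Fin m)) \ ∅).card = m := by rw [sdiff_empty, card_univ, Fintype.card_fin]
  exact sahiE_comp_strictMono_eq μ F (univ \ ∅) h id (fun x => by simp) strictMono_id

/-! ### Slot bookkeeping -/

/-- Multiplying slot `l` and moving it to the front. [this work] -/
theorem sahiE_update_mul_eq_cons (μ : α → ℝ) :
    ∀ (q : ℕ) (F : Fin (q + 1) → α → ℝ) (l : Fin (q + 1)) (h : α → ℝ),
      sahiE μ (q + 1) (update F l (F l * h)) =
        sahiE μ (q + 1) (Fin.cons (F l * h) (fun j => F (l.succAbove j)) : Fin (q + 1) → α → ℝ)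
  | 0, F, l, h => by
    have hl : l = 0 := Fin.eq_zero l
    subst hl
    congr 1
    funext j
    have hj : j = 0 := Fin.eq_zero j
    subst hj
    rw [update_self, Fin.cons_zero]
  | q + 1, F, l, h => by
    rw [sahiE_eq_cons_succAbove μ q (update F l (F l * h)) l]
    congr 1
    funext j
    refine Fin.cases ?_ (fun j' => ?_) j
    · simp only [Fin.cons_zero, update_self]
    · simp only [Fin.cons_succ, update_of_ne (Fin.succAbove_ne l j')]

/-! ### Regrouping the pairs `(l, T)` -/

section Regroup

variable {q : ℕ}


omit [Fintype α] in
/-- `l ∉ l.succAbove(T)`. [folklore] -/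
theorem not_mem_map_succAboveEmb (l : Fin (q + 1)) (T : Finset (Fin q)) : l ∉ T.map (Fin.succAboveEmb l) := by
  rw [mem_map]
  rintro ⟨i, -, hi⟩
  exact Fin.succAbove_ne l i hi

omit [Fintype α] in
/-- `|{l} ∪ l.succAbove(T)| = |T| + 1`. [folklore] -/
theorem card_liftSet (l : Fin (q + 1)) (T : Finset (Fin q)) : (insert l (T.map (Fin.succAboveEmb l))).card = T.card + 1 := by
  rw [card_insert_of_notMem (not_mem_map_succAboveEmb l T), card_map]

omit [Fintype α] in
/-- `l.succAbove i ∈ {l} ∪ l.succAbove(T) ↔ i ∈ T`. [folklore] -/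
theorem mem_liftSet_succAbove {l : Fin (q + 1)} {T : Finset (Fin q)} {i : Fin q} :
    l.succAbove i ∈ insert l (T.map (Fin.succAboveEmb l)) ↔ i ∈ T := by
  rw [mem_insert, mem_map]
  constructor
  · rintro (h | ⟨j, hj, hji⟩)
    · exact absurd h (Fin.succAbove_ne l i)
    · have : j = i := Fin.succAbove_right_injective (p := l) hji
      rw [← this]; exact hj
  · intro h; exact Or.inr ⟨i, h, rfl⟩

omit [Fintype α] in
/-- `T ↦ {l} ∪ l.succAbove(T)` is injective. [folklore] -/
theorem liftSet_injective (l : Fin (q + 1)) : Injective (fun T : Finset (Fin q) => insert l (T.map (Fin.succAboveEmb l))) := by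
  intro T₁ T₂ hT
  have h := congrArg (fun s => s.erase l) hT
  simp only at h
  rw [erase_insert (not_mem_map_succAboveEmb l T₁), erase_insert (not_mem_map_succAboveEmb l T₂)] at h
  exact map_injective _ h

omit [Fintype α] in
/-- The image of the proper subsets of `Fin q` under `T ↦ {l} ∪ l.succAbove(T)` is the set of proper subsets of `Fin (q+1)` containing `l`.
[folklore] -/
theorem image_liftSet (l : Fin (q + 1)) :
    ((univ : Finset (Fin q)).powerset.erase univ).image (fun T : Finset (Fin q) => insert l (T.map (Fin.succAboveEmb l))) =
      ((univ : Finset (Fin (q + 1))).powerset.erase univ).filter (fun T' => l ∈ T') := by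
  ext T'
  constructor
  · intro hT'
    obtain ⟨T, hT, rfl⟩ := mem_image.1 hT'
    have hTne : T ≠ univ := (mem_erase.1 hT).1
    refine mem_filter.2 ⟨mem_erase.2 ⟨?_, mem_powerset.2 (subset_univ _)⟩, mem_insert_self _ _⟩
    intro hu
    apply hTne
    refine eq_univ_of_forall fun i => (mem_liftSet_succAbove (l := l) (T := T) (i := i)).1 ?_
    rw [hu]; exact mem_univ _
  · intro hT'
    obtain ⟨hP, hl⟩ := mem_filter.1 hT'
    have hne : T' ≠ univ := (mem_erase.1 hP).1
    refine mem_image.2 ⟨univ.filter (fun i => l.succAbove i ∈ T'), mem_erase.2 ⟨?_, mem_powerset.2 (subset_univ _)⟩, ?_⟩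
    · intro hu
      apply hne
      refine eq_univ_of_forall fun j => ?_
      by_cases hj : j = l
      · rw [hj]; exact hl
      · obtain ⟨i, rfl⟩ := Fin.exists_succAbove_eq hj
        have hi : i ∈ univ.filter (fun i => l.succAbove i ∈ T') := by rw [hu]; exact mem_univ _
        exact (mem_filter.1 hi).2
    · ext j
      by_cases hj : j = l
      · subst hj
        exact ⟨fun _ => hl, fun _ => mem_insert_self _ _⟩
      · obtain ⟨i, rfl⟩ := Fin.exists_succAbove_eq hj
        rw [mem_liftSet_succAbove, mem_filter]
        exact ⟨fun h => h.2, fun h => ⟨mem_univ _, h⟩⟩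

/-- **Regrouping**: summing `g({l} ∪ l.succAbove(T))` over all slots `l` and all proper `T ⊆ Fin q` counts each proper `T' ⊆ Fin (q+1)` exactly
`|T'|` times. [this work] -/
theorem sum_sum_liftSet (g : Finset (Fin (q + 1)) → ℝ) :
    ∑ l : Fin (q + 1), ∑ T ∈ (univ : Finset (Fin q)).powerset.erase univ, g (insert l (T.map (Fin.succAboveEmb l))) =
      ∑ T' ∈ (univ : Finset (Fin (q + 1))).powerset.erase univ, (T'.card : ℝ) * g T' := by
  have step : ∀ l : Fin (q + 1), ∑ T ∈ (univ : Finset (Fin q)).powerset.erase univ, g (insert l (T.map (Fin.succAboveEmb l))) =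
      ∑ T' ∈ (univ : Finset (Fin (q + 1))).powerset.erase univ, if l ∈ T' then g T' else 0 := by
    intro l
    have himg : ∑ T' ∈ ((univ : Finset (Fin q)).powerset.erase univ).image
        (fun T : Finset (Fin q) => insert l (T.map (Fin.succAboveEmb l))), g T' =
        ∑ T ∈ (univ : Finset (Fin q)).powerset.erase univ, g (insert l (T.map (Fin.succAboveEmb l))) :=
      sum_image fun T₁ _ T₂ _ h => liftSet_injective l h
    rw [← himg, image_liftSet, sum_filter]
  simp_rw [step]
  rw [sum_comm]
  refine sum_congr rfl fun T' _ => ?_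
  rw [← sum_filter, filter_mem_eq_inter, univ_inter, sum_const, nsmul_eq_mul]

end Regroup

/-! ### The expansion -/

omit [Fintype α] in
/-- Products over `{l} ∪ l.succAbove(T)`. [folklore] -/
theorem prod_liftSet {q : ℕ} (F : Fin (q + 1) → α → ℝ) (l : Fin (q + 1)) (T : Finset (Fin q)) :
    ∏ i ∈ insert l (T.map (Fin.succAboveEmb l)), F i = F l * ∏ i ∈ T, F (l.succAbove i) := by
  rw [prod_insert (not_mem_map_succAboveEmb l T), prod_map]
  rfl

/-- The complementary sub-family of `{l} ∪ l.succAbove(T)` in `Fin (q+1)` is the complementary sub-family of `T` in `Fin q`, read through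
`l.succAbove`. [this work] -/
theorem sahiE_subfamily_liftSet (μ : α → ℝ) {q : ℕ} (F : Fin (q + 1) → α → ℝ) (l : Fin (q + 1)) (T : Finset (Fin q)) :
    sahiE μ ((univ : Finset (Fin q)) \ T).card
        (fun i => F (l.succAbove (((univ : Finset (Fin q)) \ T).orderEmbOfFin rfl i))) =
      sahiE μ ((univ : Finset (Fin (q + 1))) \ insert l (T.map (Fin.succAboveEmb l))).card
        (fun i => F (((univ : Finset (Fin (q + 1))) \ insert l (T.map (Fin.succAboveEmb l))).orderEmbOfFin rfl i)) := by
  have hcard : ((univ : Finset (Fin (q + 1))) \ insert l (T.map (Fin.succAboveEmb l))).card = ((univ : Finset (Fin q)) \ T).card := by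
    rw [card_univ_sdiff, card_univ_sdiff, card_liftSet, Fintype.card_fin, Fintype.card_fin]
    have := card_le_univ T
    rw [Fintype.card_fin] at this
    omega
  refine sahiE_comp_strictMono_eq μ F _ hcard (fun i => l.succAbove (((univ : Finset (Fin q)) \ T).orderEmbOfFin rfl i))
    (fun x => ?_) ((Fin.strictMono_succAbove l).comp (orderEmbOfFin _ rfl).strictMono)
  have hx := orderEmbOfFin_mem ((univ : Finset (Fin q)) \ T) rfl x
  rw [mem_sdiff] at hx ⊢
  exact ⟨mem_univ _, fun h => hx.2 (mem_liftSet_succAbove.1 h)⟩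

/-- **The block expansion of Sahi's functional along one slot, every order.**  For any weight `μ`, any `q`, any functions
`F : Fin q → (α → ℝ)` and `h`:  `E_{q+1}(h, F) = q!·E(h·Π_i F_i) − Σ_{T ⊊ Fin q} |T|!·E(h·Π_{i∈T} F_i)·E_{q−|T|}(F|_{Fin q ∖ T})`, the sub-family
enumerated increasingly. [this work] -/
theorem sahiE_cons_eq_block_expansion (μ : α → ℝ) :
    ∀ (q : ℕ) (h : α → ℝ) (F : Fin q → α → ℝ),
      sahiE μ (q + 1) (Fin.cons h F : Fin (q + 1) → α → ℝ) =
        (q.factorial : ℝ) * ex μ (h * ∏ i, F i) -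
          ∑ T ∈ (univ : Finset (Fin q)).powerset.erase univ,
            (T.card.factorial : ℝ) * ex μ (h * ∏ i ∈ T, F i) *
              sahiE μ ((univ : Finset (Fin q)) \ T).card (fun i => F (((univ : Finset (Fin q)) \ T).orderEmbOfFin rfl i))
  | 0, h, F => by
    rw [sahiE_one_apply]
    simp
  | q + 1, h, F => by
    -- names for the order-`q+1` ingredients
    set P : Finset (Finset (Fin (q + 1))) := (univ : Finset (Fin (q + 1))).powerset.erase univ with hP
    set X : Finset (Fin (q + 1)) → ℝ := fun T' => ex μ (h * ∏ i ∈ T', F i) *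
      sahiE μ ((univ : Finset (Fin (q + 1))) \ T').card
        (fun i => F (((univ : Finset (Fin (q + 1))) \ T').orderEmbOfFin rfl i)) with hX
    set g : Finset (Fin (q + 1)) → ℝ := fun T' => ((T'.card - 1).factorial : ℝ) * X T' with hg
    -- each recursion term, one order down, written with `g`
    have hl : ∀ l : Fin (q + 1), sahiE μ (q + 1) (update F l (F l * h)) =
        (q.factorial : ℝ) * ex μ (h * ∏ i, F i) -
          ∑ T ∈ (univ : Finset (Fin q)).powerset.erase univ, g (insert l (T.map (Fin.succAboveEmb l))) := by
      intro l
      rw [sahiE_update_mul_eq_cons, sahiE_cons_eq_block_expansion μ q (F l * h) (fun j => F (l.succAbove j))]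
      have e1 : F l * h * ∏ i, F (l.succAbove i) = h * ∏ i, F i := by
        rw [Fin.prod_univ_succAbove F l]; ring
      rw [e1]
      congr 1
      refine sum_congr rfl fun T _ => ?_
      simp only [hg, hX, card_liftSet, Nat.add_sub_cancel, prod_liftSet]
      rw [← sahiE_subfamily_liftSet]
      ring
    rw [sahiE_fin_cons]
    simp_rw [hl]
    rw [sum_sub_distrib, sum_const, card_univ, Fintype.card_fin, nsmul_eq_mul, sum_sum_liftSet g]
    -- the target sum, split at `T' = ∅`
    have hmem : (∅ : Finset (Fin (q + 1))) ∈ P := by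
      rw [hP, mem_erase]
      exact ⟨fun h0 => absurd (h0 ▸ mem_univ (0 : Fin (q + 1))) (notMem_empty _), empty_mem_powerset _⟩
    have key : ∀ T' : Finset (Fin (q + 1)), (T'.card.factorial : ℝ) * ex μ (h * ∏ i ∈ T', F i) *
        sahiE μ ((univ : Finset (Fin (q + 1))) \ T').card
          (fun i => F (((univ : Finset (Fin (q + 1))) \ T').orderEmbOfFin rfl i)) =
        (T'.card : ℝ) * g T' + if T' = ∅ then X T' else 0 := by
      intro T'
      by_cases hT : T' = ∅
      · subst hT
        simp [hg, hX]
      · have hc : 0 < T'.card := card_pos.2 (nonempty_of_ne_empty hT)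
        have hfac : (T'.card : ℝ) * ((T'.card - 1).factorial : ℝ) = (T'.card.factorial : ℝ) := by
          exact_mod_cast Nat.mul_factorial_pred hc.ne'
        rw [if_neg hT, add_zero, hg, hX]
        simp only
        rw [← hfac]
        ring
    have hsplit : ∑ T' ∈ P, (T'.card.factorial : ℝ) * ex μ (h * ∏ i ∈ T', F i) *
        sahiE μ ((univ : Finset (Fin (q + 1))) \ T').card
          (fun i => F (((univ : Finset (Fin (q + 1))) \ T').orderEmbOfFin rfl i)) =
        (∑ T' ∈ P, (T'.card : ℝ) * g T') + sahiE μ (q + 1) F * ex μ h := by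
      rw [sum_congr rfl fun T' _ => key T', sum_add_distrib, sum_ite_eq' P ∅, if_pos hmem]
      congr 1
      rw [hX]
      simp only [prod_empty, mul_one]
      rw [← sahiE_eq_subfamily_univ, mul_comm]
    rw [hsplit]
    push_cast [Nat.factorial_succ]
    ring

end Summit.CriticalPhenomena.PercolationContinuityZ3.Theorems
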